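import Literature.Geometry.Kaehler.RiemannSurfaceIntermediateOrbitSurfacesGenus
import Literature.GroupTheory.Index.DoubleCosetCountNormalizer
import HarnessLib

/-!
# The genus of `S/H` from the geometric signature: `g_{S/H} = [G:H](γ − 1) + 1 +
# ½ Σ_j Σ_{G' ∼ G_j} (|N_G(G_j)|/|H|)(1 − |G' ∩ H|/|G_j|)` (Rojas 2007, Proposition 3.2 (3.1), AS PRINTED)

Layer `Literature/Geometry/Kaehler`, namespace `Literature.Geometry.Kaehler.RiemannSurface` (lane `lit-hodgefound`,
Track 2, seat p04, generation 41, row g41-#4).  Sequel of `RiemannSurfaceIntermediateOrbitSurfacesGenus`, whose module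
docstring says «NOT here: Rojas' Proposition 3.2 in terms of the geometric signature and normalizers `N_G(G_j)`,
Lemma 3.3 (the double-coset count)» — it proved the double-coset form (Cor. 3.4 (3.3) = Lange–Rodríguez Thm. 3.1.6,
`OrbitSurface.arithGenus_eq_index_mul_add_finsum_doubleCoset`); Lemma 3.3 is now
`Literature/GroupTheory/Index/DoubleCosetCountNormalizer` (g41-#3), and this file substitutes it to recover (3.1) as
printed.  Everything is PROVED; no definition, no instance, no named fact (net Literature debt `0`).

## Source, verbatim

A. M. Rojas, *Group actions on Jacobian varieties*, Rev. Mat. Iberoam. **23** (2007) 397–420, p. 402 (held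
`paper:doi-10-4171-rmi-500`): «**Proposition 3.2.** Let `S` be a Riemann Surface with `G`-action of geometric signature
`(γ; [m_1, C_1], …, [m_t, C_t])`. Then for each subgroup `H ≤ G` the genus of `S/H` is given by
(3.1) `g_{S/H} = [G : H](γ − 1) + 1 + ½ Σ_{j=1}^t Σ_{l ∈ Ω_{G_j}} (|N_G(G_j)|/|H|)·(1 − |G_j^{l⁻¹} ∩ H|/|G_j|)`, where
`G_j` is a representative for the conjugacy class `C_j`, and `Ω_{G_j}` is a left transversal of the normalizer `N_G(G_j)`
of `G_j` in `G`. *Proof.* Consider the cover `π^H : S/H → S/G`. We will prove the proposition by computing the terms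
appearing in its corresponding Riemann-Hurwitz formula: (3.2) `g_{S/H} = [G : H](γ − 1) + 1 + b/2` […] for every branch
value of `C_j`-type we have `[N_G(G_j) : G_j]` points on `S` with stabilizer `G_j^{l⁻¹}` […] the stabilizer for the
`H`-action has order `|G_j^{l⁻¹} ∩ H|`», p. 404: «Combining this lemma with Equation 3.1 we obtain […] **Corollary 3.4.**
[…] (3.3) `g_{S/H} = [G : H](γ − 1) + 1 + ½ Σ_{j=1}^t ([G : H] − |H\G/G_j|)`.»

## Dictionary

As in `RiemannSurfaceIntermediateOrbitSurfacesGenus`: the acting group is the type `H` (Rojas' `G`), `M` the surface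
(Rojas' `S`), `K ≤ H` the subgroup (Rojas' `H`), `M/K = OrbitSurface K M`, `M/H = OrbitSurface H M`, `γ = g(M/H)`; the
sum over the branch values `q_j` with representatives `G_j` of their types is written, as there, as a `finsum` over all
`q ∈ M/H` with `G_j = H_{q.out}` (the summand vanishes off the branch values, where `H_{q.out} = 1`); the inner sum
over `l ∈ Ω_{G_j}`, i.e. over the conjugates `G_j^{l⁻¹}` of `G_j` each counted once, is the `finsum` over
`Set.range (g ↦ gG_jg⁻¹)`.

## What is proved

**`OrbitSurface.arithGenus_eq_index_mul_add_finsum_normalizer`** (PROP. 3.2 (3.1) as printed, over `ℚ`),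
`OrbitSurface.stabilizer_out_eq_bot_of_notMem_support` (off the branch values the stabilizer is trivial),
`OrbitSurface.finsum_normalizer_term_eq_zero_of_eq_bot` (the summand of (3.1) vanishes there), and
**`OrbitSurface.arithGenus_eq_index_mul_add_sum_support_normalizer`** ((3.1) with `Σ_{j=1}^t` over the branch values
`q_1, …, q_t` of `π_G : M → M/G` as a `Finset` sum).
§2 (v2, ADD-ONLY) PROPOSITIONS 3.5 and 3.6 (p. 404: «As the cover `π_H` is Galois, the description of any branch value
is done by marking it with a number: the order of the stabilizer of any point in its fiber. We will also mark other
special points in `S/H`: the points which are not branch values in `S/H` (for the cover `S → S/H`) but which project to a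
branch value of the cover `S → S/G` will be marked with a one. […] **Proposition 3.5.** Let `S` be a Riemann Surface with
`G`-action and geometric signature `(γ; [m_1, C_1], …, [m_t, C_t])`. Then, there are
`c_k := |L_k| · [N_G(G_j) : G_j] · |G_j^{l_{k-1}⁻¹} ∩ H| / |H|` (`1 ≤ j ≤ t`, `1 ≤ k ≤ ν_j`) points on `S/H` marked with the
number `|G_j^{l_{k-1}⁻¹} ∩ H|` for the action of `H ≤ G`. **3.2. Cycle structure for the cover `π^H : S/H → S/G`.
Proposition 3.6.** […] let `q ∈ S/G` be a branch value of type `C_j` for the total covering `π_G : S → S/G`. Then the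
cycle structure of `π^H : S/H → S/G` over `q` is given by an `N_j`-tuple, where `N_j = Σ_{k=1}^{ν_j} c_{jk}`, which is of
the form `(|G_j|/|G_j^{l⁻¹} ∩ H|, …, |G_j|/|G_j^{l⁻¹} ∩ H|, …)`», with `L_{jk} = {l ∈ Ω_{G_j} : |G_j^{l⁻¹} ∩ H| = n_k}` inside a
transversal `Ω_{G_j}` of `N_G(G_j)`, i.e. `|L_{jk}| = #{conjugates G' of G_j : |G' ∩ H| = n_k}`): the mark of `Q ∈ M/K` is
`|K_{Q.out}|` (`OrbitSurface.natCard_stabilizer_out_mk`: any point over `Q` will do), `natCard_stabilizer_subgroup_smul_eq_natCard_inf`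
(the mark of `π_K(g·p)` is `|K ∩ gH_pg⁻¹|`), **`OrbitSurface.ncard_setOf_factor_eq_mark_eq_natCard_doubleCoset_mark`** (points
over `π_H p` of mark `n` ↔ double cosets `KgH_p` of mark `n`), PROP. 3.5 **`OrbitSurface.natCard_mul_natCard_mul_ncard_setOf_factor_eq_mark_eq`**
(`|H_p|·|K|·c = n·|N_H(H_p)|·#{K' ∼ H_p : |K ∩ K'| = n}`) and its printed division form
**`OrbitSurface.ncard_setOf_factor_eq_mark_eq_div`** (`c = |L|·[N_H(H_p) : H_p]·n/|K|`); PROP. 3.6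
**`OrbitSurface.ramificationNumber_factor_mul_natCard_stabilizer_out`** (`mult_Q f_{K,H} · |K_{Q.out}| = |H_p|` on the fibre
over `π_H p`), **`OrbitSurface.ramificationNumber_factor_mk_smul_eq_div`** (`mult_{π_K(g·p)} f_{K,H} = |H_p|/|K ∩ gH_pg⁻¹|`),
`OrbitSurface.setOf_factor_eq_ramificationNumber_eq` and
**`OrbitSurface.natCard_mul_natCard_mul_ncard_setOf_factor_eq_ramificationNumber_eq`** (the number of entries `e = |H_p|/n`
in the cycle structure over `π_H p`).  The group theory (double cosets sorted by mark) is
`Literature/GroupTheory/Index/DoubleCosetCountNormalizer` §4.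

## References

* [Rojas2007] A. M. Rojas, *Group actions on Jacobian varieties*, Rev. Mat. Iberoam. 23 (2007), Prop. 3.2 (3.1) with
  proof, Lemma 3.3, Cor. 3.4 (3.3), Prop. 3.5, Prop. 3.6 (pp. 402–404).
* [Khovanskii2013] A. Khovanskii, *Galois Theory, Coverings, and Riemann Surfaces*, Springer (2013), §2.2.3.
* [Miranda1995] R. Miranda, *Algebraic Curves and Riemann Surfaces*, AMS GSM 5 (1995), Chapter III §3.
* [LangeRodriguez2022] H. Lange, R. E. Rodríguez, *Decomposition of Jacobians by Prym Varieties*, LNM 2310 (2022),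
  Thm. 3.1.6.
-/

noncomputable section

open scoped Manifold ContDiff Topology
open Set Function MulAction

namespace Literature.Geometry.Kaehler

namespace RiemannSurface

section Prop32

variable {H M : Type*} [Group H] [MulAction H M] [TopologicalSpace M] [ChartedSpace ℂ M]
  [IsManifold 𝓘(ℂ, ℂ) ω M] [HolomorphicSMul H M] [Finite H] [FaithfulSMul H M] [T2Space M]
  [CompactSpace M] [PreconnectedSpace M] [Nonempty M]

open OrbitSurface Literature.GroupTheory.Index

/-- **PROPOSITION 3.2 (3.1), as printed: `g(M/K) = [H:K](g(M/H) − 1) + 1 +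
½ Σ_q Σ_{K' ∼ H_q} (|N_H(H_q)|/|K|)·(1 − |K' ∩ K|/|H_q|)`** (`H_q = H_{q.out}` the stabilizer of a point over `q`, the
inner sum over its distinct conjugates `K' = gH_qg⁻¹` — «`l ∈ Ω_{G_j}`, a left transversal of `N_G(G_j)`»; the outer sum
has non-zero terms only at the branch values of `π_H`). Obtained from Cor. 3.4 (3.3) by Lemma 3.3, reversing «Combining
this lemma with Equation 3.1 we obtain (3.3)». [cite: Rojas2007, Prop. 3.2 (3.1), Lemma 3.3, Cor. 3.4 (3.3)]
[cite: LangeRodriguez2022, Thm. 3.1.6] -/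
theorem OrbitSurface.arithGenus_eq_index_mul_add_finsum_normalizer (K : Subgroup H) :
    (arithGenus (OrbitSurface K M) : ℚ) =
      K.index * ((arithGenus (OrbitSurface H M) : ℚ) - 1) + 1 +
        1 / 2 * ∑ᶠ q : OrbitSurface H M,
          ∑ᶠ K' ∈ Set.range (fun g : H ↦ (stabilizer H q.out).map (MulAut.conj g).toMonoidHom),
            ((Nat.card ↥(Subgroup.normalizer (stabilizer H q.out : Set H)) : ℚ) / Nat.card K) *
              (1 - (Nat.card ↥(K' ⊓ K) : ℚ) / Nat.card (stabilizer H q.out)) := by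
  rw [arithGenus_eq_index_mul_add_finsum_doubleCoset K]
  congr 2
  exact finsum_congr fun q ↦ index_sub_natCard_doubleCoset_eq_finsum K (stabilizer H q.out)

/-- Off the branch values of `π_H : M → M/H` the stabilizer of a point over `q` is trivial (`B_π(q) = #π⁻¹(q)·(r_q − 1)`
with `#π⁻¹(q) ≠ 0`). [cite: Rojas2007, §2 («a maximal collection of branch values»), Prop. 3.2 (proof)] -/
theorem OrbitSurface.stabilizer_out_eq_bot_of_notMem_support {q : OrbitSurface H M}
    (hq : q ∉ (branchDiv (mk H : M → OrbitSurface H M)).support) : stabilizer H q.out = ⊥ := by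
  rw [Finsupp.notMem_support_iff, branchDiv_mk_apply] at hq
  have hfib : (((mk H : M → OrbitSurface H M) ⁻¹' {q}).ncard : ℤ) ≠ 0 := by
    have hq' : (mk H : M → OrbitSurface H M) ⁻¹' {q} = orbit H q.out := by
      have h := preimage_mk_singleton (H := H) (M := M) q.out
      rwa [mk_out] at h
    have hfin : (orbit H q.out).Finite := Set.finite_range fun g : H ↦ g • q.out
    rw [hq', Nat.cast_ne_zero]
    exact ((Set.ncard_pos hfin).mpr ⟨q.out, mem_orbit_self q.out⟩).ne'
  have h1 : (stabOrder q : ℤ) - 1 = 0 := (mul_eq_zero.mp hq).resolve_left hfib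
  have h2 : Nat.card (stabilizer H q.out) = 1 := by
    have h3 : (stabOrder q : ℤ) = 1 := by linarith
    exact_mod_cast h3
  exact Subgroup.eq_bot_of_card_eq _ h2

omit [MulAction H M] [TopologicalSpace M] [ChartedSpace ℂ M] [IsManifold 𝓘(ℂ, ℂ) ω M] [HolomorphicSMul H M]
  [FaithfulSMul H M] [T2Space M] [CompactSpace M] [PreconnectedSpace M] [Nonempty M] [Finite H] in
/-- The summand of (3.1) at a trivial stabilizer vanishes: the only conjugate of `1` is `1`, and `1 − |1 ∩ K|/|1| = 0`.
[cite: Rojas2007, Prop. 3.2 (proof)] -/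
theorem OrbitSurface.finsum_normalizer_term_eq_zero_of_eq_bot (K : Subgroup H) {L : Subgroup H} (hL : L = ⊥) :
    ∑ᶠ K' ∈ Set.range (fun g : H ↦ L.map (MulAut.conj g).toMonoidHom),
        ((Nat.card ↥(Subgroup.normalizer (L : Set H)) : ℚ) / Nat.card K) *
          (1 - (Nat.card ↥(K' ⊓ K) : ℚ) / Nat.card L) = 0 := by
  subst hL
  refine finsum_mem_of_eqOn_zero fun K' hK' ↦ ?_
  obtain ⟨g, rfl⟩ := hK'
  simp only [Pi.zero_apply]
  rw [Subgroup.map_bot, bot_inf_eq, Subgroup.card_bot, Nat.cast_one, div_one, sub_self, mul_zero]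

open Classical in
/-- **PROPOSITION 3.2 (3.1) with `Σ_{j=1}^t` over the branch values `q_1, …, q_t` of `π_H : M → M/H`**:
`g(M/K) = [H:K](g(M/H) − 1) + 1 + ½ Σ_{q ∈ Br(π_H)} Σ_{K' ∼ H_q} (|N_H(H_q)|/|K|)(1 − |K' ∩ K|/|H_q|)`.
[cite: Rojas2007, Prop. 3.2 (3.1)] [cite: LangeRodriguez2022, Thm. 3.1.6] -/
theorem OrbitSurface.arithGenus_eq_index_mul_add_sum_support_normalizer (K : Subgroup H) :
    (arithGenus (OrbitSurface K M) : ℚ) =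
      K.index * ((arithGenus (OrbitSurface H M) : ℚ) - 1) + 1 +
        1 / 2 * ∑ q ∈ (branchDiv (mk H : M → OrbitSurface H M)).support,
          ∑ᶠ K' ∈ Set.range (fun g : H ↦ (stabilizer H q.out).map (MulAut.conj g).toMonoidHom),
            ((Nat.card ↥(Subgroup.normalizer (stabilizer H q.out : Set H)) : ℚ) / Nat.card K) *
              (1 - (Nat.card ↥(K' ⊓ K) : ℚ) / Nat.card (stabilizer H q.out)) := by
  rw [arithGenus_eq_index_mul_add_finsum_normalizer K, finsum_eq_sum_of_support_subset]
  intro q hq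
  rw [Finset.mem_coe]
  by_contra hq'
  exact hq (finsum_normalizer_term_eq_zero_of_eq_bot K (stabilizer_out_eq_bot_of_notMem_support hq'))

end Prop32

/-! ### §2 (v2, ADD-ONLY) PROPOSITIONS 3.5 and 3.6: the marked points of `M/K` over a branch value of `π_H`, and the
cycle structure of `f_{K,H} : M/K → M/H` over it -/

section Prop35

variable {H M : Type*} [Group H] [MulAction H M] [TopologicalSpace M] [ChartedSpace ℂ M]
  [IsManifold 𝓘(ℂ, ℂ) ω M] [HolomorphicSMul H M] [Finite H] [FaithfulSMul H M] [T2Space M]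
  [CompactSpace M] [PreconnectedSpace M] [Nonempty M]

open OrbitSurface Literature.GroupTheory.Index

omit [TopologicalSpace M] [ChartedSpace ℂ M] [IsManifold 𝓘(ℂ, ℂ) ω M] [HolomorphicSMul H M] [Finite H]
  [FaithfulSMul H M] [T2Space M] [CompactSpace M] [PreconnectedSpace M] [Nonempty M] in
/-- **The mark of a point `Q ∈ M/K` — «the order of the stabilizer of any point in its fiber» — does not depend on the
point**: `|K_{Q.out}| = |K_x|` for `Q = π_K x`. [cite: Rojas2007, §3.1 (marked points, p. 404)] [cite: Miranda1995, Chapter III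
Lemma 3.6 (proof)] -/
theorem OrbitSurface.natCard_stabilizer_out_mk (K : Subgroup H) (x : M) :
    Nat.card (stabilizer K (mk K x : OrbitSurface K M).out) = Nat.card (stabilizer K x) := by
  obtain ⟨k, hk⟩ := mk_eq_mk_iff.1 (mk_out (mk K x : OrbitSurface K M))
  conv_rhs => rw [← hk]
  rw [card_stabilizer_smul]

omit [TopologicalSpace M] [ChartedSpace ℂ M] [IsManifold 𝓘(ℂ, ℂ) ω M] [HolomorphicSMul H M] [Finite H]
  [FaithfulSMul H M] [T2Space M] [CompactSpace M] [PreconnectedSpace M] [Nonempty M] in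
/-- **The mark of `π_K(g·p)` is `|K ∩ gH_pg⁻¹|`** («we have `[N_G(G_j) : G_j]` elements with stabilizer `G_j^l` […] the
stabilizer for the `H`-action has order `|G_j^{l⁻¹} ∩ H|`»). [cite: Rojas2007, Prop. 3.2 (proof), Prop. 3.5]
[cite: LangeRodriguez2022, proof of Theorem 3.1.6] -/
theorem natCard_stabilizer_subgroup_smul_eq_natCard_inf (K : Subgroup H) (g : H) (p : M) :
    Nat.card (stabilizer K (g • p)) = Nat.card ↥(K ⊓ (stabilizer H p).map (MulAut.conj g).toMonoidHom) := by
  rw [card_stabilizer_subgroup_eq_card_inf, stabilizer_smul_eq_stabilizer_map_conj, inf_comm]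

omit [TopologicalSpace M] [ChartedSpace ℂ M] [IsManifold 𝓘(ℂ, ℂ) ω M] [HolomorphicSMul H M] [Finite H]
  [FaithfulSMul H M] [T2Space M] [CompactSpace M] [PreconnectedSpace M] [Nonempty M] in
/-- **The points of `M/K` over `π_H p` of mark `n` are in bijection with the double cosets `KgH_p` of mark `|K ∩ gH_pg⁻¹| = n`**
(`KgH_p ↦ π_K(g·p)`; «the points of `S/H` […] marked with the number `|G_j^{l⁻¹} ∩ H|`» against the `H`-orbits on
`I_{G_j}`). [cite: Rojas2007, Prop. 3.5, Lemma 3.3 (proof)] [cite: LangeRodriguez2022, proof of Theorem 3.1.6] -/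
theorem OrbitSurface.ncard_setOf_factor_eq_mark_eq_natCard_doubleCoset_mark (K : Subgroup H) (p : M) (n : ℕ) :
    {Q : OrbitSurface K M | factor K Q = mk H p ∧ Nat.card (stabilizer K Q.out) = n}.ncard =
      Nat.card {D : DoubleCoset.Quotient (K : Set H) (stabilizer H p) |
        Nat.card ↥(K ⊓ (stabilizer H p).map (MulAut.conj D.out).toMonoidHom) = n} := by
  set f : DoubleCoset.Quotient (K : Set H) (stabilizer H p) → OrbitSurface K M := fun D ↦ mk K (D.out • p) with hf
  have hf_inj : Function.Injective f := by
    intro D₁ D₂ h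
    have h' := (mk_smul_eq_mk_smul_iff K p D₁.out D₂.out).1 h
    rwa [DoubleCoset.out_eq', DoubleCoset.out_eq'] at h'
  have himage : {Q : OrbitSurface K M | factor K Q = mk H p ∧ Nat.card (stabilizer K Q.out) = n} =
      f '' {D | Nat.card ↥(K ⊓ (stabilizer H p).map (MulAut.conj D.out).toMonoidHom) = n} := by
    ext Q
    simp only [Set.mem_setOf_eq, Set.mem_image]
    constructor
    · rintro ⟨hQ, hn⟩
      have hQ' : (mk H Q.out : OrbitSurface H M) = mk H p := by
        rw [← factor_mk K Q.out, mk_out]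
        exact hQ
      obtain ⟨g, hg⟩ := mk_eq_mk_iff.1 hQ'.symm
      refine ⟨DoubleCoset.mk K (stabilizer H p) g, ?_, ?_⟩
      · rw [natCard_inf_map_conj_out_mk, ← natCard_stabilizer_subgroup_smul_eq_natCard_inf, hg, hn]
      · rw [hf]
        change (mk K (_ • p) : OrbitSurface K M) = Q
        rw [(mk_smul_eq_mk_smul_iff K p _ g).2 (DoubleCoset.out_eq' _ _ _), hg, mk_out]
    · rintro ⟨D, hD, rfl⟩
      exact ⟨(factor_mk K _).trans (mk_smul _ _),
        by rw [natCard_stabilizer_out_mk, natCard_stabilizer_subgroup_smul_eq_natCard_inf, hD]⟩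
  rw [himage, Set.ncard_image_of_injective _ hf_inj, Nat.card_coe_set_eq]

omit [TopologicalSpace M] [ChartedSpace ℂ M] [IsManifold 𝓘(ℂ, ℂ) ω M] [HolomorphicSMul H M] [FaithfulSMul H M]
  [T2Space M] [CompactSpace M] [PreconnectedSpace M] [Nonempty M] in
/-- **PROPOSITION 3.5: the number `c` of points of `M/K` over the branch value `π_H p` (of type `H_p`) marked with the number
`n` satisfies `|H_p| · |K| · c = n · |N_H(H_p)| · #{K' ∼ H_p : |K ∩ K'| = n}`** — as printed,
`c_k = |L_k| · [N_G(G_j) : G_j] · |G_j^{l_{k-1}⁻¹} ∩ H| / |H|` with `|L_k| = #{conjugates G' of G_j : |G' ∩ H| = n}`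
(Rojas' `(G, H, G_j)` = `(H, K, H_p)` here). [cite: Rojas2007, Prop. 3.5] -/
theorem OrbitSurface.natCard_mul_natCard_mul_ncard_setOf_factor_eq_mark_eq (K : Subgroup H) (p : M) (n : ℕ) :
    Nat.card (stabilizer H p) * (Nat.card K *
      {Q : OrbitSurface K M | factor K Q = mk H p ∧ Nat.card (stabilizer K Q.out) = n}.ncard) =
      n * (Nat.card ↥(Subgroup.normalizer (stabilizer H p : Set H)) *
        {K' ∈ Set.range (fun g : H ↦ (stabilizer H p).map (MulAut.conj g).toMonoidHom) |
          Nat.card ↥(K ⊓ K') = n}.ncard) := by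
  rw [ncard_setOf_factor_eq_mark_eq_natCard_doubleCoset_mark]
  exact natCard_mul_natCard_mul_natCard_doubleCoset_mark_eq K (stabilizer H p) n

omit [TopologicalSpace M] [ChartedSpace ℂ M] [IsManifold 𝓘(ℂ, ℂ) ω M] [HolomorphicSMul H M] [FaithfulSMul H M]
  [T2Space M] [CompactSpace M] [PreconnectedSpace M] [Nonempty M] in
/-- **PROPOSITION 3.5, as printed: `c = |L| · [N_H(H_p) : H_p] · n / |K|`** points of `M/K` over `π_H p` are marked with
the number `n`, where `|L| = #{K' ∼ H_p : |K ∩ K'| = n}` («`c_k := |L_k| · [N_G(G_j) : G_j] · |G_j^{l_{k-1}⁻¹} ∩ H| / |H|` points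
on `S/H` marked with the number `|G_j^{l_{k-1}⁻¹} ∩ H|`»; over `ℚ`). [cite: Rojas2007, Prop. 3.5] -/
theorem OrbitSurface.ncard_setOf_factor_eq_mark_eq_div (K : Subgroup H) (p : M) (n : ℕ) :
    ({Q : OrbitSurface K M | factor K Q = mk H p ∧ Nat.card (stabilizer K Q.out) = n}.ncard : ℚ) =
      {K' ∈ Set.range (fun g : H ↦ (stabilizer H p).map (MulAut.conj g).toMonoidHom) | Nat.card ↥(K ⊓ K') = n}.ncard *
        ((Nat.card ↥(Subgroup.normalizer (stabilizer H p : Set H)) : ℚ) / Nat.card (stabilizer H p) * n) /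
          Nat.card K := by
  rw [ncard_setOf_factor_eq_mark_eq_natCard_doubleCoset_mark]
  exact natCard_doubleCoset_mark_eq_div K (stabilizer H p) n

omit [CompactSpace M] [Nonempty M] in
/-- **The cycle structure of `f_{K,H}` over `π_H p`: at a point `Q` of the fibre, `mult_Q f_{K,H} · |K_{Q.out}| = |H_p|`** —
the ramification of `f_{K,H}` at a point of mark `n` over a branch value of type `H_p` is `|H_p|/n` («the cycle structure of
`π^H : S/H → S/G` over `q` is given by […] `|G_j|/|G_j^{l⁻¹} ∩ H|`»). [cite: Rojas2007, Prop. 3.6] [cite: Khovanskii2013, §2.2.3] -/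
theorem OrbitSurface.ramificationNumber_factor_mul_natCard_stabilizer_out {K : Subgroup H} {p : M} {Q : OrbitSurface K M}
    (hQ : factor K Q = mk H p) :
    ramificationNumber (factor K : OrbitSurface K M → OrbitSurface H M) Q * Nat.card (stabilizer K Q.out) =
      Nat.card (stabilizer H p) := by
  have h := ramificationNumber_factor_mk_mul K Q.out
  rw [mk_out] at h
  have hQ' : (mk H Q.out : OrbitSurface H M) = mk H p := by
    rw [← factor_mk K Q.out, mk_out]
    exact hQ
  obtain ⟨g, hg⟩ := mk_eq_mk_iff.1 hQ'.symm
  rw [h, ← hg, card_stabilizer_smul]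

omit [CompactSpace M] [Nonempty M] in
/-- **PROPOSITION 3.6 (the entries of the cycle structure): `mult_{π_K(g·p)} f_{K,H} = |H_p| / |K ∩ gH_pg⁻¹|`** («the cycle
structure of `π^H : S/H → S/G` over `q` [of type `C_j`] is given by an `N_j`-tuple […] of the form
`(|G_j|/|G_j^{l⁻¹} ∩ H|, …)`»). [cite: Rojas2007, Prop. 3.6] -/
theorem OrbitSurface.ramificationNumber_factor_mk_smul_eq_div (K : Subgroup H) (g : H) (p : M) :
    ramificationNumber (factor K : OrbitSurface K M → OrbitSurface H M) (mk K (g • p)) =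
      Nat.card (stabilizer H p) / Nat.card ↥(K ⊓ (stabilizer H p).map (MulAut.conj g).toMonoidHom) := by
  have h := ramificationNumber_factor_mk_mul K (g • p)
  rw [card_stabilizer_smul, natCard_stabilizer_subgroup_smul_eq_natCard_inf] at h
  exact (Nat.div_eq_of_eq_mul_left Nat.card_pos h.symm).symm

omit [CompactSpace M] [Nonempty M] in
/-- Over `π_H p`, «marked with `n`» and «ramification `e`» single out the same points when `e · n = |H_p|`.
[cite: Rojas2007, Prop. 3.5, Prop. 3.6] -/
theorem OrbitSurface.setOf_factor_eq_ramificationNumber_eq (K : Subgroup H) (p : M) {e n : ℕ}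
    (hen : e * n = Nat.card (stabilizer H p)) :
    {Q : OrbitSurface K M | factor K Q = mk H p ∧
        ramificationNumber (factor K : OrbitSurface K M → OrbitSurface H M) Q = e} =
      {Q : OrbitSurface K M | factor K Q = mk H p ∧ Nat.card (stabilizer K Q.out) = n} := by
  have hpos : 0 < Nat.card (stabilizer H p) := Nat.card_pos
  have he : 0 < e := Nat.pos_of_ne_zero fun he ↦ by rw [he, zero_mul] at hen; exact hpos.ne hen
  have hn : 0 < n := Nat.pos_of_ne_zero fun hn ↦ by rw [hn, mul_zero] at hen; exact hpos.ne hen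
  ext Q
  simp only [Set.mem_setOf_eq]
  constructor
  · rintro ⟨hQ, hQe⟩
    refine ⟨hQ, ?_⟩
    have h := ramificationNumber_factor_mul_natCard_stabilizer_out hQ
    rw [hQe, ← hen] at h
    exact Nat.eq_of_mul_eq_mul_left he h
  · rintro ⟨hQ, hQn⟩
    refine ⟨hQ, ?_⟩
    have h := ramificationNumber_factor_mul_natCard_stabilizer_out hQ
    rw [hQn, ← hen] at h
    exact Nat.eq_of_mul_eq_mul_right hn h

omit [CompactSpace M] [Nonempty M] in
/-- **PROPOSITION 3.6 with 3.5: the number `c` of points of the fibre of `f_{K,H}` over `π_H p` with ramification `e`, where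
`e · n = |H_p|`, satisfies `|H_p| · |K| · c = n · |N_H(H_p)| · #{K' ∼ H_p : |K ∩ K'| = n}`** (the cycle structure over a
branch value of type `H_p` has `c_{jk}` entries equal to `|G_j|/|G_j^{l_{k-1}⁻¹} ∩ H|`). [cite: Rojas2007, Prop. 3.6, Prop. 3.5] -/
theorem OrbitSurface.natCard_mul_natCard_mul_ncard_setOf_factor_eq_ramificationNumber_eq (K : Subgroup H) (p : M)
    {e n : ℕ} (hen : e * n = Nat.card (stabilizer H p)) :
    Nat.card (stabilizer H p) * (Nat.card K *
      {Q : OrbitSurface K M | factor K Q = mk H p ∧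
        ramificationNumber (factor K : OrbitSurface K M → OrbitSurface H M) Q = e}.ncard) =
      n * (Nat.card ↥(Subgroup.normalizer (stabilizer H p : Set H)) *
        {K' ∈ Set.range (fun g : H ↦ (stabilizer H p).map (MulAut.conj g).toMonoidHom) |
          Nat.card ↥(K ⊓ K') = n}.ncard) := by
  rw [setOf_factor_eq_ramificationNumber_eq K p hen]
  exact natCard_mul_natCard_mul_ncard_setOf_factor_eq_mark_eq K p n

end Prop35

end RiemannSurface

end Literature.Geometry.Kaehler

end
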